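import Summits.BirchSwinnertonDyer.BirchSwinnertonDyer.Theorems.EisensteinPrimesMazurMCOnCellBTwistbackSubrowCarrierBernoulli
import HarnessLib

/-!
# Crux 3 `MazurMCOnCellB` (stmt-BirchSwinnertonDyer-19033), line `twistback` v5 — the KL-FLAT CARRIER of the twist at
# EVERY odd `p` for ARBITRARY line characters, part 2: the SECOND X2b shape (line unramified-even, carrier `Wd/Ψ₀`)

LEAD bsd-line-x2-p1 g12 (2026-08-28). HONEST FRAMING (cell `bsd-eis`, run/shared/lean/pub/bsd-eis/): bookkeeping
THEOREMS ONLY (no `def`, no named fact introduced, no `sorry`); `--supports` stmt-BirchSwinnertonDyer-19033; closes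
no registered stub; no summit statement, no Mazur main conjecture and no BSD is proved for any curve; 0 cells /
labels / tiers move.

WHY. In the registered skeleton v5 (sha256 355e1eaf…) the open stub `stub_upperPartnerOffSubrow` asks (∃-PARTNER)
off the closed sub-row «`p = 3`, non-split, balance 1». Its sub-population (iii) — non-split X2b pairs at `p ≠ 3` —
is served, `K` GIVEN, by LEAD g11's `…TwistbackSubrowCarrier{,Even}` (p653533 / p653853) + `…SubrowPartnerGiven`
(p654672), but ONLY for a QUADRATIC unramified character (`ψ` resp. `φ`; automatic at `p = 3`, not at `p ≥ 5`),
because the KL-flat unit is read off a CLASS NUMBER (`p ∤ h(−n·|d_K|)`, w3 g7's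
`norm_twistedBernoulli_teichmullerLift_inv_eq_one_iff_of_isPrimitive`). That is the ONLY place quadraticity enters:
the twist-line package (w3 g8), the Weil relation (p652931), `ψ′(p) ≠ 1` (w7), LEAD g10's
`klFlat_of_norm_twistedBernoulli_eq_one` and the balance transfer are character-general. This file re-issues both
constructions with `(hquad, hh)` replaced by the generalized-Bernoulli unit of the twisted character, stated on the
INPUT data through the Jacobi symbol of `|d_K|` (w3 g8's quadratic Kronecker–Weber gives `χ_K(a) = (a/|d_K|)`):
  `‖B_{1, θ}‖_p = 1`, `θ(a) = ω̃((ψ(a)·(a/|d_K|))⁻¹)` (first shape) resp. `ω̃((φ(a)·(a/|d_K|))⁻¹)` (second shape),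
`ω̃ = teichmullerLift p`, period `d·|d_K|` resp. `m·|d_K|` — i.e. `p ∤ B_{1,(ψχ_K)⁻¹}` with the Euler factor at `p`
included (`θ` vanishes on `pℤ` through `ω̃(0) = 0` exactly as in `characterLValueD`). For quadratic `ψ` this is
`p ∤ 2h(−d·|d_K|)/w` (w3 g7), recovering p653533.

* (part 1 `…SubrowCarrierBernoulli`: `exists_klFlatCarrier_twist_of_ramifiedOdd_of_bernoulliUnit`, FIRST shape.)
* HERE `exists_klFlatCarrier_twist_of_unramifiedEven_of_bernoulliUnit` — SECOND shape (line unramified-even; `p ∤ m`,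
  `p ∣ d`; ANY primitive `φ`), carrier `Wd/Ψ₀`; conclusion VERBATIM the binder `hKL` of p645525 §3 / p650387.
(The `K`-given doors — stub 6′'s conclusion at `(W, p)` from these carriers — are one application of LEAD g10's
`upperPartner_at_of_klFlat_partner{,_of_thmE}` away; sequel `…SubrowPartnerGivenBernoulli`.) What stays OPEN for
sub-population (iii): the SUPPLY of such `K` at `p ≥ 5` (an imaginary quadratic field in a residue class mod `p·M`
with a Bernoulli unit) — not in print (Wiles 2015 / Beckwith 2017 prescribe no condition at `p`; verdict g12 §2).

References: [GreenbergVatsal2000] Thm. (1.3), §2 p. 28, Prop. (2.4), §3 (26)–(28); [Washington1997] Thm. 4.2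
(generalized Bernoulli numbers), Thm. 5.11, Ch. 3; [LangCyclotomic1990] Ch. 2 §2 (B 6–B 7), Ch. 4 §3 Thm. 3.2;
[SilvermanATAEC1994] Thm. V.5.3, Cor. V.5.4; [SilvermanAEC2009] X.5 Cor. 5.4, VII.5 Prop. 5.1, Cor. VII.7.2;
[Knapp1993] Thm. 11.67; [Cox2013] (1.17), Thm. 7.7 (ii); [IrelandRosen1990] Prop. 6.3.2, Prop. 20.5.4.
-/

set_option autoImplicit false

-- `Summit.BirchSwinnertonDyer.BirchSwinnertonDyer.…`: the summit and its single sub-problem share a name.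
set_option linter.dupNamespace false

noncomputable section

open scoped Classical NumberTheorySymbols

open WeierstrassCurve NumberField IsDedekindDomain Field DirichletCharacter Rat.HeightOneSpectrum
  Literature.NumberTheory.EllipticCurves Literature.NumberTheory.GaloisRepresentations
  Literature.NumberTheory.EllipticCurves.Rank1Residual Literature.NumberTheory.EllipticCurves.GreenbergVatsal2000
  Literature.NumberTheory.QuadraticFields
  Summit.BirchSwinnertonDyer.Rank1Residual Summit.BirchSwinnertonDyer.Rank1Residual.X2
  Summit.BirchSwinnertonDyer.BirchSwinnertonDyer.Theorems.EisensteinPrimesLineWeilRelation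
  Summit.BirchSwinnertonDyer.BirchSwinnertonDyer.Theorems.EisensteinPrimesMazurMCOnCellBTwistbackTwistLineCharacters
  Summit.BirchSwinnertonDyer.BirchSwinnertonDyer.Theorems.EisensteinPrimesMazurMCOnCellBTwistbackTwistLineCharactersPackage
  Summit.BirchSwinnertonDyer.BirchSwinnertonDyer.Theorems.EisensteinPrimesMazurMCOnCellBTwistbackTwistLocalBalance
  Summit.BirchSwinnertonDyer.BirchSwinnertonDyer.Theorems.EisensteinPrimesMazurMCOnCellBTwistbackQuadraticRadical
  Summit.BirchSwinnertonDyer.BirchSwinnertonDyer.Theorems.EisensteinPrimesMazurMCOnCellBTwistbackKLFlatPartnerUnits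
  Summit.BirchSwinnertonDyer.BirchSwinnertonDyer.Theorems.EisensteinPrimesMazurMCOnCellBTwistbackPartnerClassNumberLift
  Summit.BirchSwinnertonDyer.BirchSwinnertonDyer.Theorems.EisensteinPrimesLinePsiAtMultiplicativePrime
  Summit.BirchSwinnertonDyer.BirchSwinnertonDyer.Theorems.EisensteinPrimesMazurMCOnCellBTwistbackSubrowCarrier
  Literature.NumberTheory.EllipticCurves.TateCurve
  Summit.BirchSwinnertonDyer.BirchSwinnertonDyer.Theorems.EisensteinPrimesMazurMCOnCellBTwistbackSubrowCarrierEven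

namespace Summit.BirchSwinnertonDyer.BirchSwinnertonDyer.Theorems.EisensteinPrimesMazurMCOnCellBTwistbackSubrowCarrierBernoulliEven

/-! ## SECOND X2b shape (line of `E` unramified-even), any primitive `φ`; carrier `Wd/Ψ₀` -/

/-- **The KL-flat carrier of the twist, CONSTRUCTED — second X2b shape, ARBITRARY characters.** As §1 with the line
`Φ₀ ≤ W[p]` UNRAMIFIED at `p` and EVEN, primitive `φ` (mod `m`, `p ∤ m`; ANY order) on the line and `ψ` (mod `d`,
`p ∣ d`) on the quotient, and the generalized-Bernoulli unit `‖B_{1,θ}‖_p = 1` for `θ(a) = ω̃((φ(a)·(a/|d_K|))⁻¹)` of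
period `m·|d_K|`. Conclusion: the binder `hKL` VERBATIM at every minimal model `Wd` of `W^{(d_K)}`, the carrier being
the globally minimal curve `V′` `ℚ`-isogenous to `Wd` that carries the image line (RAMIFIED-EVEN, characters
`ψ·(·/|d_K|)` on the line, `φ·(·/|d_K|)` on the quotient — w3 g8 package §3–§4 with the Tate facts discharged by the
tree's `Silverman1994_thmV53{_corV54}_tateUniformisation_holds`), `S₀′ = S₀ ∪ {v ∣ d_K}`; `δ` and good reduction
move along the isogeny. p653853 is the case `φ` quadratic.
[cite: GreenbergVatsal2000, Thm. (1.3), §2 p. 28 (E′ = E/Φ) and Prop. (2.4), §3 (26)–(28)]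
[cite: Washington1997, Thm. 4.2 and Thm. 5.11] [cite: SilvermanATAEC1994, Thm. V.5.3 and Cor. V.5.4]
[cite: SilvermanAEC2009, Cor. VII.7.2] [cite: Knapp1993, Thm. 11.67] [cite: Cox2013, §1.C (1.17) and Thm. 7.7 (ii)] -/
theorem exists_klFlatCarrier_twist_of_unramifiedEven_of_bernoulliUnit
    (W : WeierstrassCurve ℚ) [W.IsElliptic] [W.IsGloballyMinimal] (p : ℕ) [Fact p.Prime]
    (hX : ClassX2 W p) (hns : ¬ W.HasSplitMultiplicativeReductionAtPrime p)
    {Φ₀ : AddSubgroup (geomTorsion W (p : ℤ))} (hΦ : IsRationalLine W p Φ₀)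
    (hunr : LineUnramifiedAt W p Φ₀) (heven : LineEven W p Φ₀)
    {m : ℕ} [NeZero m] (φ : DirichletCharacter (ZMod p) m) {d : ℕ} [NeZero d]
    (ψ : DirichletCharacter (ZMod p) d) (hφ : φ.IsPrimitive) (hψ : ψ.IsPrimitive) (hpm : ¬ p ∣ m)
    (hpd : p ∣ d)
    (hφ0 : ∀ (σ : absoluteGaloisGroup ℚ), ∀ P ∈ Φ₀,
      σ • P = (φ ((modNCyclotomicCharacter ℚ m σ : (ZMod m)ˣ) : ZMod m)).val • P)
    (hψ0 : ∀ (σ : absoluteGaloisGroup ℚ) (P : geomTorsion W (p : ℤ)),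
      σ • P - (ψ ((modNCyclotomicCharacter ℚ d σ : (ZMod d)ˣ) : ZMod d)).val • P ∈ Φ₀)
    (S₀ : Finset (HeightOneSpectrum (𝓞 ℚ))) (hS₀p : ∀ v ∈ S₀, ((p : ℕ) : 𝓞 ℚ) ∉ v.asIdeal)
    (hS : ∀ v : HeightOneSpectrum (𝓞 ℚ), v ∉ S₀ → ((p : ℕ) : 𝓞 ℚ) ∉ v.asIdeal → W.HasGoodReductionAt v)
    (hbal : 1 + ∑ v ∈ S₀, delta W p v =
      ∑ v ∈ S₀, ((if φ (Rat.HeightOneSpectrum.natGenerator v : ZMod m) =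
            (Rat.HeightOneSpectrum.natGenerator v : ZMod p)
          then sFactor p (Rat.HeightOneSpectrum.natGenerator v) else 0) +
        (if ψ (Rat.HeightOneSpectrum.natGenerator v : ZMod d) =
            (Rat.HeightOneSpectrum.natGenerator v : ZMod p)
          then sFactor p (Rat.HeightOneSpectrum.natGenerator v) else 0)))
    (K : Type) [Field K] [NumberField K] (hK : IsImaginaryQuadratic K)
    (hHp : SatisfiesHeegnerHypothesis p K) (hK4 : NumberField.discr K % 4 = 1) (hlt : NumberField.discr K < -4)
    {N₀ : ℕ} (hHN₀ : SatisfiesHeegnerHypothesis N₀ K)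
    (hS₀N₀ : ∀ v ∈ S₀, Rat.HeightOneSpectrum.natGenerator v ∣ N₀)
    (hmK : m.Coprime (NumberField.discr K).natAbs) (hdK : d.Coprime (NumberField.discr K).natAbs)
    (hB : ‖twistedBernoulli p 1 (m * (NumberField.discr K).natAbs) (fun a : ℕ ↦ teichmullerLift p
        (φ (a : ZMod m) * ((J((a : ℤ) | (NumberField.discr K).natAbs) : ℤ) : ZMod p))⁻¹)‖ = 1) :
    ∀ (Wd : WeierstrassCurve ℚ) [Wd.IsElliptic] [Wd.IsGloballyMinimal],
      (∃ C : VariableChange ℚ, C • Wd = W.quadraticTwist (NumberField.discr K : ℚ)) →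
      ∃ (V' : WeierstrassCurve ℚ) (_ : V'.IsElliptic) (_ : V'.IsGloballyMinimal), IsIsogenous Wd V' ∧
        ∃ (S₀' : Finset (HeightOneSpectrum (𝓞 ℚ))) (Φ₀' : AddSubgroup (V'.geomTorsion (p : ℤ)))
          (m' : ℕ) (_ : NeZero m') (φ' : DirichletCharacter (ZMod p) m')
          (d' : ℕ) (_ : NeZero d') (ψ' : DirichletCharacter (ZMod p) d'),
          IsRationalLine V' p Φ₀' ∧ ¬ LineUnramifiedAt V' p Φ₀' ∧ LineEven V' p Φ₀' ∧
          φ'.IsPrimitive ∧ ψ'.IsPrimitive ∧ p ∣ m' ∧ ¬ p ∣ d' ∧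
          (∀ (σ : absoluteGaloisGroup ℚ), ∀ Q ∈ Φ₀',
            σ • Q = (φ' ((modNCyclotomicCharacter ℚ m' σ : (ZMod m')ˣ) : ZMod m')).val • Q) ∧
          (∀ (σ : absoluteGaloisGroup ℚ) (Q : V'.geomTorsion (p : ℤ)),
            σ • Q - (ψ' ((modNCyclotomicCharacter ℚ d' σ : (ZMod d')ˣ) : ZMod d')).val • Q ∈ Φ₀') ∧
          (∀ v ∈ S₀', ((p : ℕ) : 𝓞 ℚ) ∉ v.asIdeal) ∧
          (∀ v : HeightOneSpectrum (𝓞 ℚ), v ∉ S₀' → ((p : ℕ) : 𝓞 ℚ) ∉ v.asIdeal →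
            V'.HasGoodReductionAt v) ∧
          ‖characterLValueC p φ' ∅ 1‖ = 1 ∧ ‖characterLValueD p ψ' ∅ 1‖ = 1 ∧
          1 + ∑ v ∈ S₀', delta V' p v =
            ∑ v ∈ S₀', ((if φ' (Rat.HeightOneSpectrum.natGenerator v : ZMod m') =
                  (Rat.HeightOneSpectrum.natGenerator v : ZMod p)
                then sFactor p (Rat.HeightOneSpectrum.natGenerator v) else 0) +
              (if ψ' (Rat.HeightOneSpectrum.natGenerator v : ZMod d') =
                  (Rat.HeightOneSpectrum.natGenerator v : ZMod p)
                then sFactor p (Rat.HeightOneSpectrum.natGenerator v) else 0)) := by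
  intro Wd _ _ hWd
  obtain ⟨C, hC⟩ := hWd
  have hp : p.Prime := Fact.out
  haveI : NeZero p := ⟨hp.ne_zero⟩
  have hp2 : p ≠ 2 := hX.1
  have hmult : W.HasMultiplicativeReductionAtPrime p := hX.2.2
  have h2 : Module.finrank ℚ K = 2 := hK.1
  have hD0 : NumberField.discr K < 0 := hK.discr_neg
  have hpD : ¬ (p : ℤ) ∣ NumberField.discr K := not_dvd_discr_of_split hK hp hp2 hHp
  -- `N = |d_K|`, odd, squarefree, `> 4`, prime to `p`
  set N : ℕ := (NumberField.discr K).natAbs with hNdef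
  have hNZ : (N : ℤ) = -NumberField.discr K := Int.ofNat_natAbs_of_nonpos hD0.le
  have hN0 : N ≠ 0 := Int.natAbs_ne_zero.mpr (NumberField.discr_ne_zero K)
  haveI : NeZero N := ⟨hN0⟩
  have hN4 : 4 < N := by omega
  have hpN : ¬ p ∣ N := fun h ↦ by
    rw [← Int.natCast_dvd_natCast, hNZ, dvd_neg] at h
    exact hpD h
  have hsq : Squarefree N := by
    rcases Quadratic.isFundamentalDiscriminant_discr (K := K) h2 with ⟨-, hsf, -⟩ | ⟨h4, -, -⟩
    · exact Int.squarefree_natAbs.mpr hsf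
    · exfalso; omega
  -- the quadratic character `χ = (·/|d_K|)` of `K`
  obtain ⟨χ, hχ2, hχp, hχJ, hχτ⟩ := exists_quadraticChar_geomSqrt_of_emod_four (p := p) hp2 hK4 hsq
  -- the twist is multiplicative at `p`; the isogenous carrier with its ramified-even line (w3 g8 package §3–§4)
  have hmultd : Wd.HasMultiplicativeReductionAtPrime p := (X2.classX2_twist W p hX K hK hHp Wd ⟨C, hC⟩).2.2
  obtain ⟨V', hV', hV'min, hiso, Φ', hline, hram', hev', hprimψ', hprimφ', hpdN, hpmN, hψ'0, hφ'0⟩ :=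
    exists_isogenous_twistLine_ramifiedEven_characters (W := W) (Wd := Wd)
      Silverman1994_thmV53_tateUniformisation_holds Silverman1994_thmV53_corV54_tateUniformisation_holds hp2 hD0 hpD
      χ hχ2 hχτ hχp hΦ hunr heven φ ψ hφ hψ hpm hpd hmK hdK hφ0 hψ0 hmultd C hC
  set φq : DirichletCharacter (ZMod p) (m * N) :=
    changeLevel (dvd_mul_right m N) φ * changeLevel (dvd_mul_left N m) (χ.ringHomComp (Int.castRingHom (ZMod p)))
    with hφqdef
  set ψl : DirichletCharacter (ZMod p) (d * N) :=
    changeLevel (dvd_mul_right d N) ψ * changeLevel (dvd_mul_left N d) (χ.ringHomComp (Int.castRingHom (ZMod p)))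
    with hψldef
  obtain ⟨f⟩ := hiso
  -- the places of `d_K`
  obtain ⟨T, hT⟩ := exists_finset_places_dvd N hN0
  have hTdvd : ∀ v ∈ T, ((Rat.HeightOneSpectrum.natGenerator v : ℕ) : ℤ) ∣ NumberField.discr K := fun v hv ↦ by
    have h := (hT v).mp hv
    rw [← Int.natCast_dvd_natCast, hNZ, dvd_neg] at h
    exact h
  have hTp : ∀ v ∈ T, Rat.HeightOneSpectrum.natGenerator v ≠ p := fun v hv h ↦ hpN (h ▸ (hT v).mp hv)
  have hS₀T : ∀ v ∈ S₀, v ∉ T := fun v hv hvT ↦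
    Literature.SatisfiesHeegnerHypothesis.not_dvd_discr h2 hHN₀ (prime_natGenerator v) (hS₀N₀ v hv) (hTdvd v hvT)
  have hST : Disjoint S₀ T := Finset.disjoint_left.mpr hS₀T
  have hpv : ∀ v : HeightOneSpectrum (𝓞 ℚ), ((p : ℕ) : 𝓞 ℚ) ∉ v.asIdeal ↔
      Rat.HeightOneSpectrum.natGenerator v ≠ p := fun v ↦ by
    rw [Rat.natCast_mem_asIdeal_iff v, Nat.dvd_prime hp]
    have h1 : Rat.HeightOneSpectrum.natGenerator v ≠ 1 := (prime_natGenerator v).ne_one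
    tauto
  -- the units on `V′`: Weil relation, `(φχ̄)(p) ≠ 1`, the class number
  have hφψ' := weilRelation_of_line hline hprimψ' hprimφ' hψ'0 hφ'0
  have hφqp : φq (p : ZMod (m * N)) ≠ 1 :=
    (psi_natCast_ne_one_of_twist_carrier W p hp2 hmult hns K hK hHp Wd ⟨C, hC⟩ V' ⟨f⟩ hline hram' φq hpmN
      hφ'0).2
  -- the Bernoulli unit: the twisted character `φq = φ·(·/|d_K|)` agrees pointwise with the Jacobi form of `hB`
  have hfun : (fun a : ℕ ↦ teichmullerLift p (φq (a : ZMod (m * N)))⁻¹) = fun a : ℕ ↦ teichmullerLift p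
      (φ (a : ZMod m) * ((J((a : ℤ) | N) : ℤ) : ZMod p))⁻¹ := by
    funext a
    rw [hφqdef, changeLevel_mul_changeLevel_apply_natCast, ringHomComp_apply_eq_intCast, hχJ]
  have hB' : ‖twistedBernoulli p 1 (m * N) (fun a : ℕ ↦ teichmullerLift p (φq (a : ZMod (m * N)))⁻¹)‖ = 1 := by
    rw [hfun]; exact hB
  obtain ⟨hC1, hD1⟩ := klFlat_of_norm_twistedBernoulli_eq_one p ψl φq hp2 hφψ' hφqp hB'
  -- good reduction of `Wd`, hence of `V′`, off `S₀ ∪ T ∪ {p}`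
  have hC' : C⁻¹ • W.quadraticTwist (NumberField.discr K : ℚ) = Wd := by rw [← hC, inv_smul_smul]
  have hgoodV' : ∀ v : HeightOneSpectrum (𝓞 ℚ), v ∉ S₀ ∪ T → ((p : ℕ) : 𝓞 ℚ) ∉ v.asIdeal →
      V'.HasGoodReductionAt v := by
    intro v hv hvp
    rw [Finset.mem_union, not_or] at hv
    have hW : W.HasGoodReductionAt v := hS v hv.1 hvp
    haveI : Fact (Rat.HeightOneSpectrum.natGenerator v).Prime := ⟨prime_natGenerator v⟩
    have hW' : W.HasGoodReductionAtPrime (Rat.HeightOneSpectrum.natGenerator v) :=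
      (hasGoodReductionAtPrime_iff_hasGoodReductionAt_ringOfIntegers W (v := v)).mpr hW
    have hℓD : ¬ ((Rat.HeightOneSpectrum.natGenerator v : ℕ) : ℤ) ∣ NumberField.discr K := by
      intro h
      apply hv.2
      rw [hT, ← Int.natCast_dvd_natCast, hNZ]
      exact dvd_neg.mpr h
    have hWd' := GenusKolyTwin.hasGoodReductionAtPrime_twist_of_not_dvd W hK4 C⁻¹ hC'
      (Rat.HeightOneSpectrum.natGenerator v) hW' hℓD
    have hisoN : IsIsogenous Wd V' := ⟨f⟩
    exact (WeierstrassCurve.IsIsogenous.hasGoodReductionAt_iff_of_isIsogenous hisoN v).mp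
      ((hasGoodReductionAtPrime_iff_hasGoodReductionAt_ringOfIntegers Wd (v := v)).mp hWd')
  -- the balance transfer «c(E^K) = c(E)», moved along the isogeny
  have hδV : ∀ v : HeightOneSpectrum (𝓞 ℚ), delta V' p v = delta Wd p v := fun v ↦
    (delta_eq_of_localPolynomialAt_eq p (f.localPolynomialAt_eq_of_isElliptic v)).symm
  have hδS : ∀ v ∈ S₀, delta V' p v = delta W p v := fun v hv ↦ by
    rw [hδV, delta_twist_eq_of_heegner W K p h2 hHN₀ v (hS₀N₀ v hv) C hC]
  have hδT : ∀ v ∈ T, delta V' p v = 0 := fun v hv ↦ by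
    rw [hδV]
    exact delta_twist_eq_zero_of_dvd_discr W K p h2 v (hTdvd v hv)
      (hS v (fun hvS ↦ hS₀T v hvS hv) ((hpv v).mpr (hTp v hv))) C hC
  have hχ1 : ∀ v ∈ S₀, χ (Rat.HeightOneSpectrum.natGenerator v : ZMod N) = 1 := by
    intro v hv
    by_cases h2v : Rat.HeightOneSpectrum.natGenerator v = 2
    · have h8 : NumberField.discr K % 8 = 1 :=
        Literature.SatisfiesHeegnerHypothesis.discr_emod_eight h2 hHN₀ (h2v ▸ hS₀N₀ v hv)
      rw [hχJ, h2v]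
      exact Monsky1990.jacobiSym_two_of_mod_eight_seven (by omega)
    · exact chi_natCast_eq_one_of_heegner h2 hK4 hHN₀ χ hχJ (prime_natGenerator v) h2v (hS₀N₀ v hv)
  have hφS : ∀ v ∈ S₀, ψl (Rat.HeightOneSpectrum.natGenerator v : ZMod (d * N)) =
      ψ (Rat.HeightOneSpectrum.natGenerator v : ZMod d) := fun v hv ↦
    twistChar_natCast_of_apply_eq_one ψ χ (hχ1 v hv)
  have hψS : ∀ v ∈ S₀, φq (Rat.HeightOneSpectrum.natGenerator v : ZMod (m * N)) =
      φ (Rat.HeightOneSpectrum.natGenerator v : ZMod m) := fun v hv ↦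
    twistChar_natCast_of_apply_eq_one φ χ (hχ1 v hv)
  have hncop : ∀ v ∈ T, ¬ (Rat.HeightOneSpectrum.natGenerator v).Coprime N := fun v hv h ↦
    (Nat.Prime.coprime_iff_not_dvd (prime_natGenerator v)).mp h ((hT v).mp hv)
  have hφT : ∀ v ∈ T, ψl (Rat.HeightOneSpectrum.natGenerator v : ZMod (d * N)) = 0 := fun v hv ↦
    twistChar_natCast_of_not_coprime ψ χ (hncop v hv)
  have hψT : ∀ v ∈ T, φq (Rat.HeightOneSpectrum.natGenerator v : ZMod (m * N)) = 0 := fun v hv ↦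
    twistChar_natCast_of_not_coprime φ χ (hncop v hv)
  have hTp' : ∀ v ∈ T, (Rat.HeightOneSpectrum.natGenerator v : ZMod p) ≠ 0 := fun v hv h ↦ by
    rw [ZMod.natCast_eq_zero_iff, Nat.dvd_prime (prime_natGenerator v)] at h
    rcases h with h | h
    · exact hp.ne_one h
    · exact hTp v hv h.symm
  -- `E`'s balance in the order (ψ, φ)
  have hbal0 : 1 + ∑ v ∈ S₀, delta W p v =
      ∑ v ∈ S₀, ((if ψ (Rat.HeightOneSpectrum.natGenerator v : ZMod d) =
            (Rat.HeightOneSpectrum.natGenerator v : ZMod p)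
          then sFactor p (Rat.HeightOneSpectrum.natGenerator v) else 0) +
        (if φ (Rat.HeightOneSpectrum.natGenerator v : ZMod m) =
            (Rat.HeightOneSpectrum.natGenerator v : ZMod p)
          then sFactor p (Rat.HeightOneSpectrum.natGenerator v) else 0)) := by
    rw [hbal]
    exact Finset.sum_congr rfl fun v _ ↦ add_comm _ _
  have hbal' := (balance_union_iff (W := W) (Wd := V') ψ φ ψl φq S₀ T hST hδS hδT hφS hψS hφT hψT hTp' 1).mpr hbal0
  -- assemble
  refine ⟨V', hV', hV'min, ⟨f⟩, S₀ ∪ T, Φ', d * N, inferInstance, ψl, m * N, inferInstance, φq,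
    hline, hram', hev', hprimψ', hprimφ', hpdN, hpmN, hψ'0, hφ'0, ?_, hgoodV', hC1, hD1, hbal'⟩
  intro v hv
  rcases Finset.mem_union.mp hv with hv | hv
  · exact hS₀p v hv
  · exact (hpv v).mpr (hTp v hv)

end Summit.BirchSwinnertonDyer.BirchSwinnertonDyer.Theorems.EisensteinPrimesMazurMCOnCellBTwistbackSubrowCarrierBernoulliEven

end
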